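import Summits.AnomalousDissipation.AnomalousDissipation.Theorems.WindLineWindLineReachesCalm
import Summits.AnomalousDissipation.AnomalousDissipation.Theorems.WindLineWindLineFeedsTarget

/-!
# Crux `CyclicWindLineLoud` (stmt-AnomalousDissipation-11415), line `birth` — stub
`stub_farShoreOnWindLine`: the far shore lies on the wind-line

For the cyclic force `f = (sin 2πx₃, sin 2πx₁, sin 2πx₂)` and the wind direction `e = (1, √2, √3)`,
at every viscosity `ν > 0` and resolution `N` (`S = freqBall N`) there is a wind threshold `s₁` such that
every windy steady Galerkin state `c ∈ V` of wind `s ≥ s₁` (`c 0 = s·e`),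
`V = {c ∈ galerkinSubspace S : c 0 ∈ ℝ e_ℂ, galerkinRHS S ν ĝ c = 0}`, lies on the WIND-LINE: its connected
component in `V` reaches every wind `Λ`.

## Proof (the first two thirds of `WindLineReachesCalm.windLine_reaches_calm`, with a simpler key step)

* `farShore_subset_windLine` (general finite symmetric `S ∋ 0`, any dimension, any non-resonant `e`,
  any real solenoidal `g` without mean mode): every `c ∈ V` has wake `‖c_k‖ ≤ ρ = ‖g‖₂/(4π²ν)` off the
  mean mode (`norm_apply_le_of_galerkinRHS_eq_zero`); for `|s| ≥ s₁(ρ)` the wind slice `V ∩ {wind = s}`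
  has at most one point (`eq_of_galerkinRHS_eq_of_wind_ge`); and for every `Λ'` the zeros of the
  parametrised calm field over the wind slab `[-Λ', Λ']` contain a connected set `K` projecting ONTO
  `[-Λ', Λ']` (`exists_isConnected_zeros_of_bilin_coercive`, coercivity from `sum_re_inner_galerkinRHS_le`).
  For `c ∈ V` of wind `s ≥ max s₁ 0` and any `Λ`, take `Λ' = max Λ s`: the image of `K` in `V` is
  preconnected, contains a point of wind exactly `s` — which by uniqueness IS `c` — and a point of wind
  `Λ' ≥ Λ`; so it lies in the connected component of `c`, which therefore reaches wind `≥ Λ`.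
  (No intermediate value theorem is needed, unlike in `windLine_reaches_calm`.)
* Specialisation: `e = !₂[1, √2, √3]` complexifies to the literal `!₂[1, √2, √3] : ℂ³` of the crux
  (`complexify_windDir`); it is non-resonant on all of `ℤ³ ∖ 0` (`windDir_nonresonant`: if
  `k₀ + √2 k₁ + √3 k₂ = 0` then `2√6 k₁k₂ = k₀² - 2k₁² - 3k₂²` forces `k₁k₂ = 0` by irrationality of `√6`,
  then `√2` resp. `√3` irrational forces `k = 0`); the cyclic force vector `ĝ|_S` is real and solenoidal
  (`isRealCoeff_mFourierCoeff`, `IsDivFree.isTransversal_mFourierCoeff`) with `ĝ(0) = 0` (the mean mode is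
  off the first shell, `cycForce_eq_realTrigPoly`); `freqBall N` is symmetric and contains `0`.

Sources: F. E. Browder (1960) / Solan–Solan (2023) (tree: `BrowderContinuation`); R. Temam, *Navier–Stokes
Equations* (1979), Ch. II (1.29)–(1.30); FoiasTemam1977 / TemamNSNFA1995 Thm 10.4 (continuation in a
parameter, here the wind).
-/

-- `Summit.<Summit>.<Problem>` is the tree's mandated summit-side namespace (CONVENTIONS §2); for this
-- single-conjunct summit the two coincide, so the duplicate is deliberate.
set_option linter.dupNamespace false

noncomputable section

open scoped BigOperators InnerProductSpace ComplexConjugate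
open Set Function

namespace Summit.AnomalousDissipation.AnomalousDissipation.Theorems.CyclicWindLineLoud.FarShore

open Literature.Analysis.FunctionSpaces Literature.Analysis.FunctionSpaces.Torus
open Literature.Analysis.FluidPDE Literature.Analysis.FluidPDE.Torus
open Summit.AnomalousDissipation.AnomalousDissipation.Theorems.WindLineReachesCalm
open Summit.AnomalousDissipation.AnomalousDissipation.Theorems.WindLineCyclic

variable {d : Type*} [Fintype d] {S : Finset (d → ℤ)}

/-! ## §1 The far shore lies on the wind-line — general symmetric frequency set -/

/-- **The far shore lies on the wind-line** (general form). Let `S` be a finite symmetric frequency set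
containing the mean mode, `g ∈ galerkinSubspace S` a force without mean mode, `e` non-resonant on `S ∖ 0`,
`ν > 0`, and `V = {c ∈ galerkinSubspace S : c 0 ∈ ℝ e_ℂ, galerkinRHS S ν g c = 0}` the windy steady
Galerkin variety. There is a wind threshold `s₁` such that for every `c ∈ V` of wind `s ≥ s₁`
(`c 0 = s e_ℂ`) and every `Λ`, the connected component of `c` in `V` contains a state of wind `≥ Λ`.
A-priori wake bound from the energy identity, uniqueness of windy steady states at large wind, and the
Browder continuum of zeros over the wind slab `[-Λ', Λ']`, `Λ' = max Λ s`, which passes through `c`;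
see the module docstring. [folklore] -/
theorem farShore_subset_windLine (hS : ∀ k ∈ S, -k ∈ S) (h0 : (0 : d → ℤ) ∈ S)
    {g : ↥S → EuclideanSpace ℂ d} (hg : g ∈ galerkinSubspace S) (hg0 : g ⟨0, h0⟩ = 0)
    {e : EuclideanSpace ℝ d} (he : ∀ k : ↥S, (k : d → ℤ) ≠ 0 → ∑ i, e i * ((k : d → ℤ) i : ℝ) ≠ 0)
    {ν : ℝ} (hν : 0 < ν) {V : Set (↥S → EuclideanSpace ℂ d)}
    (hV : V = {c | c ∈ galerkinSubspace S ∧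
      (∃ s : ℝ, ∀ k : ↥S, (k : d → ℤ) = 0 → c k = (s : ℂ) • EuclideanSpace.complexify e) ∧
      galerkinRHS S ν g c = 0}) :
    ∃ s₁ : ℝ, ∀ c ∈ V, ∀ s : ℝ, s₁ ≤ s → c ⟨0, h0⟩ = (s : ℂ) • EuclideanSpace.complexify e →
      ∀ Λ : ℝ, ∃ c' ∈ connectedComponentIn V c, ∃ s' : ℝ,
        c' ⟨0, h0⟩ = (s' : ℂ) • EuclideanSpace.complexify e ∧ Λ ≤ s' := by
  classical
  set E : EuclideanSpace ℂ d := EuclideanSpace.complexify e with hE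
  have hVmem : ∀ x, x ∈ V ↔ x ∈ galerkinSubspace S ∧
      (∃ s : ℝ, x ⟨0, h0⟩ = (s : ℂ) • E) ∧ galerkinRHS S ν g x = 0 := by
    intro x
    rw [hV, mem_setOf_eq]
    simp only [forall_coe_eq_zero_iff h0]
  -- the degenerate direction `e = 0`: the wind coordinate is mute, every `c ∈ V` has every wind
  by_cases he0 : e = 0
  · have hE0 : E = 0 := by rw [hE, he0, map_zero]
    refine ⟨0, fun c hc s _ hcs Λ => ⟨c, mem_connectedComponentIn hc, Λ, ?_, le_rfl⟩⟩
    rw [hcs, hE0, smul_zero, smul_zero]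
  -- the wind coordinate
  obtain ⟨σ, hσc, hσ⟩ := exists_windCoordinate h0 he0
  have hσV : ∀ x ∈ V, x ⟨0, h0⟩ = (σ x : ℂ) • E := by
    intro x hx
    obtain ⟨-, ⟨s, hs⟩, -⟩ := (hVmem x).1 hx
    rw [hσ x s hs, hs]
  -- a-priori bound on the wakes of windy steady states
  set ρ : ℝ := Real.sqrt (∑ k : ↥S, ‖g k‖ ^ 2) / (4 * Real.pi ^ 2 * ν) with hρ
  have hρ0 : 0 ≤ ρ := by positivity
  have hbound : ∀ x ∈ V, ∀ k : ↥S, (k : d → ℤ) ≠ 0 → ‖x k‖ ≤ ρ := by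
    intro x hx k hk
    obtain ⟨hxY, -, hxz⟩ := (hVmem x).1 hx
    exact norm_apply_le_of_galerkinRHS_eq_zero hν hS h0 hg.1 hg0 hxY hxz hk
  -- uniqueness at large wind
  obtain ⟨s₁, hs₁⟩ := eq_of_galerkinRHS_eq_of_wind_ge h0 e he hρ0
  have huniq : ∀ x ∈ V, ∀ y ∈ V, s₁ ≤ |σ x| → σ x = σ y → x = y := by
    intro x hx y hy hsx hxy
    obtain ⟨hxY, -, hxz⟩ := (hVmem x).1 hx
    obtain ⟨hyY, -, hyz⟩ := (hVmem y).1 hy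
    refine hs₁ ν g (σ x) hsx x y hxY.2 hyY.2 (hσV x hx) ?_ (hbound x hx) (hbound y hy) ?_
    · rw [hxy]; exact hσV y hy
    · rw [hxz, hyz]
  -- the calm subspace `W`, its `ℓ²` form, and the wind direction vector
  set Y := galerkinSubspace S with hY
  set W : Submodule ℝ (↥S → EuclideanSpace ℂ d) :=
    Y ⊓ LinearMap.ker (LinearMap.proj (⟨0, h0⟩ : ↥S) :
      (↥S → EuclideanSpace ℂ d) →ₗ[ℝ] EuclideanSpace ℂ d) with hW
  have hWmem : ∀ x, x ∈ W ↔ x ∈ Y ∧ x ⟨0, h0⟩ = 0 := by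
    intro x
    rw [hW, Submodule.mem_inf, LinearMap.mem_ker, LinearMap.proj_apply]
  obtain ⟨B₀, hB₀⟩ : ∃ B₀ : (↥S → EuclideanSpace ℂ d) →ₗ[ℝ] (↥S → EuclideanSpace ℂ d) →ₗ[ℝ] ℝ,
      ∀ x y, B₀ x y = ∑ k : ↥S, (inner ℂ (x k) (y k)).re :=
    ⟨LinearMap.mk₂ ℝ (fun x y => ∑ k : ↥S, (inner ℂ (x k) (y k)).re)
      (fun x₁ x₂ y => by
        simp only [Pi.add_apply, inner_add_left, Complex.add_re, Finset.sum_add_distrib])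
      (fun a x y => by
        simp only [Pi.smul_apply, real_smul_eq_coe_smul, inner_smul_left, Complex.conj_ofReal,
          Complex.re_ofReal_mul, Finset.mul_sum, smul_eq_mul])
      (fun x y₁ y₂ => by
        simp only [Pi.add_apply, inner_add_right, Complex.add_re, Finset.sum_add_distrib])
      (fun a x y => by
        simp only [Pi.smul_apply, real_smul_eq_coe_smul, inner_smul_right, Complex.re_ofReal_mul,
          Finset.mul_sum, smul_eq_mul]),
      fun _ _ => rfl⟩
  obtain ⟨B, hB_apply⟩ : ∃ B : W →ₗ[ℝ] W →ₗ[ℝ] ℝ, ∀ x y : W, B x y =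
      ∑ k : ↥S, (inner ℂ ((x : ↥S → EuclideanSpace ℂ d) k) ((y : ↥S → EuclideanSpace ℂ d) k)).re :=
    ⟨B₀.compl₁₂ W.subtype W.subtype, fun x y => hB₀ _ _⟩
  have hB_self : ∀ x : W, B x x = ∑ k : ↥S, ‖(x : ↥S → EuclideanSpace ℂ d) k‖ ^ 2 := by
    intro x
    rw [hB_apply]
    refine Finset.sum_congr rfl fun k _ => ?_
    rw [← RCLike.re_to_complex, inner_self_eq_norm_sq]
  have hB_pos : ∀ x : W, x ≠ 0 → 0 < B x x := by
    intro x hx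
    rw [hB_self]
    have hx' : (x : ↥S → EuclideanSpace ℂ d) ≠ 0 := fun h => hx (Subtype.ext h)
    obtain ⟨k, hk⟩ : ∃ k, (x : ↥S → EuclideanSpace ℂ d) k ≠ 0 := Function.ne_iff.1 hx'
    exact lt_of_lt_of_le (pow_pos (norm_pos_iff.2 hk) 2)
      (Finset.single_le_sum (f := fun k => ‖(x : ↥S → EuclideanSpace ℂ d) k‖ ^ 2)
        (fun k _ => sq_nonneg _) (Finset.mem_univ k))
  set eh : ↥S → EuclideanSpace ℂ d := Pi.single (⟨0, h0⟩ : ↥S) E with heh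
  have hehY : eh ∈ Y := single_complexify_mem_galerkinSubspace h0 e
  -- the affine embedding of `ℝ × W` onto the windy phase space
  set emb : ℝ → W → (↥S → EuclideanSpace ℂ d) := fun s x => (x : ↥S → EuclideanSpace ℂ d) + s • eh
    with hemb
  have hembY : ∀ s x, emb s x ∈ Y := fun s x => Y.add_mem ((hWmem x).1 x.2).1 (Y.smul_mem s hehY)
  have hemb0 : ∀ s x, emb s x ⟨0, h0⟩ = (s : ℂ) • E := by
    intro s x
    rw [hemb]
    dsimp only
    rw [Pi.add_apply, ((hWmem x).1 x.2).2, zero_add, Pi.smul_apply, heh, Pi.single_eq_same,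
      real_smul_eq_coe_smul]
  have hemb_ne : ∀ s x (k : ↥S), (k : d → ℤ) ≠ 0 → emb s x k = (x : ↥S → EuclideanSpace ℂ d) k := by
    intro s x k hk
    have hk' : k ≠ ⟨0, h0⟩ := fun h => hk (by rw [h])
    rw [hemb]
    dsimp only
    rw [Pi.add_apply, Pi.smul_apply, heh, Pi.single_eq_of_ne hk', smul_zero, add_zero]
  have hembc : Continuous fun p : ℝ × W => emb p.1 p.2 :=
    (continuous_subtype_val.comp continuous_snd).add (continuous_fst.smul continuous_const)
  have hembV : ∀ s x, galerkinRHS S ν g (emb s x) = 0 → emb s x ∈ V := fun s x hz =>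
    (hVmem _).2 ⟨hembY s x, ⟨s, hemb0 s x⟩, hz⟩
  -- the parametrised calm field and its coercivity
  have hRHS_W : ∀ s x, galerkinRHS S ν g (emb s x) ∈ W := fun s x =>
    (hWmem _).2 ⟨galerkinRHS_mem ν hS hg.1 (hembY s x),
      galerkinRHS_apply_zero ν h0 hg0 (hembY s x).2⟩
  set Vf : ℝ → W → W := fun s x => ⟨galerkinRHS S ν g (emb s x), hRHS_W s x⟩ with hVf
  have hVfc : Continuous fun p : ℝ × W => Vf p.1 p.2 :=
    Continuous.subtype_mk ((continuous_galerkinRHS ν).comp (continuous_const.prodMk hembc)) _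
  have hcoer : ∀ (s : ℝ) (x : W), ρ ^ 2 ≤ B x x → B (Vf s x) x ≤ 0 := by
    intro s x hx
    have hsum : B (Vf s x) x = ∑ k : ↥S, (inner ℂ (emb s x k) (galerkinRHS S ν g (emb s x) k)).re := by
      rw [hB_apply]
      refine Finset.sum_congr rfl fun k _ => ?_
      by_cases hk : (k : d → ℤ) = 0
      · have hk' : k = ⟨0, h0⟩ := Subtype.ext hk
        rw [hk']
        show (inner ℂ (galerkinRHS S ν g (emb s x) ⟨0, h0⟩) _).re = _
        rw [galerkinRHS_apply_zero ν h0 hg0 (hembY s x).2, inner_zero_left, inner_zero_right]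
      · rw [← hemb_ne s x k hk, ← inner_conj_symm, Complex.conj_re]
    have hβ : ∑ k : ↥S, (if (k : d → ℤ) = 0 then 0 else ‖emb s x k‖ ^ 2) = B x x := by
      rw [hB_self]
      refine Finset.sum_congr rfl fun k _ => ?_
      split_ifs with hk
      · have hk' : k = ⟨0, h0⟩ := Subtype.ext hk
        rw [hk', ((hWmem x).1 x.2).2, norm_zero]
        ring
      · rw [hemb_ne s x k hk]
    have hle := sum_re_inner_galerkinRHS_le hν.le hS h0 hg.1 hg0 (hembY s x)
    rw [hβ, ← hsum] at hle
    -- `√(B x x) ≥ ρ = ‖g‖₂ / (4π²ν)`, so the right-hand side is `≤ 0`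
    have hb0 : 0 ≤ B x x := (sq_nonneg ρ).trans hx
    have hsq : ρ ≤ Real.sqrt (B x x) := by
      rw [← Real.sqrt_sq hρ0]
      exact Real.sqrt_le_sqrt hx
    have hγ : Real.sqrt (∑ k : ↥S, ‖g k‖ ^ 2) = 4 * Real.pi ^ 2 * ν * ρ := by
      rw [hρ]
      field_simp
    rw [hγ] at hle
    have h1 : 4 * Real.pi ^ 2 * ν * ρ * Real.sqrt (B x x) ≤
        4 * Real.pi ^ 2 * ν * (Real.sqrt (B x x) * Real.sqrt (B x x)) := by
      rw [mul_assoc]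
      exact mul_le_mul_of_nonneg_left (mul_le_mul_of_nonneg_right hsq (Real.sqrt_nonneg _))
        (by positivity)
    rw [Real.mul_self_sqrt hb0] at h1
    linarith
  -- the threshold: beyond `max s₁ 0` every windy steady state lies on the Browder continuum over its slab
  refine ⟨max s₁ 0, fun c hc s hs hcs Λ => ?_⟩
  have hcV := hc
  have hs0 : 0 ≤ s := le_trans (le_max_right _ _) hs
  have hs1 : s₁ ≤ s := le_trans (le_max_left _ _) hs
  have hσcs : σ c = s := hσ c s hcs
  -- Browder continuation over the wind slab `[-Λ', Λ']`, `Λ' = max Λ s`, transported into `V`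
  set Λ' : ℝ := max Λ s with hΛ'
  have hΛ'0 : 0 ≤ Λ' := hs0.trans (le_max_right _ _)
  have hab : -Λ' ≤ Λ' := by linarith
  obtain ⟨K, hK, hKconn, hKproj⟩ := exists_isConnected_zeros_of_bilin_coercive B hB_pos hVfc hab
    (fun s _ x hx => hcoer s x hx)
  set θ : ℝ × W → (↥S → EuclideanSpace ℂ d) := fun p => emb p.1 p.2 with hθ
  have hθV : ∀ p ∈ K, θ p ∈ V := by
    intro p hp
    obtain ⟨-, hz⟩ := hK hp
    exact hembV p.1 p.2 (congrArg Subtype.val hz)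
  have hθσ : ∀ p ∈ K, σ (θ p) = p.1 := fun p _ => hσ _ _ (hemb0 p.1 p.2)
  have hK'conn : IsPreconnected (θ '' K) := (hKconn.image θ hembc.continuousOn).isPreconnected
  have hK'V : θ '' K ⊆ V := by
    rintro _ ⟨p, hp, rfl⟩
    exact hθV p hp
  -- points of `K` at winds `Λ'` and `s`
  have hpt : ∀ t ∈ Icc (-Λ') Λ', ∃ p ∈ K, p.1 = t := by
    intro t ht
    rw [← hKproj] at ht
    obtain ⟨p, hp, rfl⟩ := ht
    exact ⟨p, hp, rfl⟩
  obtain ⟨pΛ, hpΛ, hpΛ1⟩ := hpt Λ' ⟨hab, le_rfl⟩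
  obtain ⟨ps, hps, hps1⟩ := hpt s ⟨by linarith, le_max_right _ _⟩
  -- by uniqueness at wind `s ≥ s₁`, `c` is the point of `K` at wind `s`
  have heq : c = θ ps := by
    refine huniq c hcV (θ ps) (hθV ps hps) ?_ ?_
    · rw [hσcs, abs_of_nonneg hs0]
      exact hs1
    · rw [hσcs, hθσ ps hps, hps1]
  -- hence the whole connected set `θ '' K` lies in the component of `c`
  have hsub : θ '' K ⊆ connectedComponentIn V c := by
    rw [heq]
    exact hK'conn.subset_connectedComponentIn (mem_image_of_mem θ hps) hK'V
  refine ⟨θ pΛ, hsub (mem_image_of_mem θ hpΛ), Λ', ?_, le_max_left _ _⟩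
  show emb pΛ.1 pΛ.2 ⟨0, h0⟩ = ((Λ' : ℝ) : ℂ) • E
  rw [hemb0, hpΛ1]

/-! ## §2 The cyclic force and the wind direction `(1, √2, √3)` -/

/-- The wind direction `e = (1, √2, √3) : ℝ³` complexifies to the literal `(1, √2, √3) : ℂ³` of the crux.
[folklore] -/
theorem complexify_windDir :
    EuclideanSpace.complexify (!₂[(1 : ℝ), Real.sqrt 2, Real.sqrt 3] : EuclideanSpace ℝ (Fin 3)) =
      !₂[(1 : ℂ), ((Real.sqrt 2 : ℝ) : ℂ), ((Real.sqrt 3 : ℝ) : ℂ)] := by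
  ext i
  fin_cases i <;> simp [EuclideanSpace.complexify_apply]

/-- If `x` is irrational and `x·q = r` with integers `q, r`, then `q = 0`. [folklore] -/
theorem int_eq_zero_of_irrational_mul_eq {x : ℝ} (hx : Irrational x) {q r : ℤ}
    (h : x * (q : ℝ) = (r : ℝ)) : q = 0 := by
  by_contra hq
  have hq' : ((q : ℤ) : ℝ) ≠ 0 := by exact_mod_cast hq
  refine (irrational_iff_ne_rational x).1 hx r q hq ?_
  rw [← h, mul_div_cancel_right₀ _ hq']

/-- **`(1, √2, √3)` is non-resonant on `ℤ³ ∖ 0`**: `k₀ + √2 k₁ + √3 k₂ ≠ 0` for every integer vector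
`k ≠ 0` (`ℚ`-linear independence of `1, √2, √3`: squaring `√2 k₁ + √3 k₂ = -k₀` gives
`2√6 k₁k₂ = k₀² - 2k₁² - 3k₂²`, so `k₁k₂ = 0` as `√6 ∉ ℚ`; then `√3 ∉ ℚ` resp. `√2 ∉ ℚ` forces `k = 0`).
[folklore] -/
theorem windDir_nonresonant (k : Fin 3 → ℤ) (hk : k ≠ 0) :
    ∑ i, (!₂[(1 : ℝ), Real.sqrt 2, Real.sqrt 3] : EuclideanSpace ℝ (Fin 3)) i * ((k i : ℤ) : ℝ) ≠ 0 := by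
  intro h
  simp only [Fin.sum_univ_three, Fin.isValue, Matrix.cons_val_zero, Matrix.cons_val_one, Matrix.cons_val_two,
    Matrix.head_cons, Matrix.tail_cons, one_mul] at h
  -- `h : k₀ + √2 k₁ + √3 k₂ = 0`
  have hs2 : Real.sqrt 2 * Real.sqrt 2 = 2 := Real.mul_self_sqrt (by norm_num)
  have hs3 : Real.sqrt 3 * Real.sqrt 3 = 3 := Real.mul_self_sqrt (by norm_num)
  have hs6 : Real.sqrt 2 * Real.sqrt 3 = Real.sqrt 6 := by
    rw [← Real.sqrt_mul (by norm_num : (0 : ℝ) ≤ 2) 3]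
    norm_num
  have h2 : Irrational (Real.sqrt 2) := irrational_sqrt_two
  have h3 : Irrational (Real.sqrt 3) := Nat.Prime.irrational_sqrt (p := 3) (by norm_num)
  have h6 : Irrational (Real.sqrt 6) := by norm_num
  -- `2√6 k₁k₂` is an integer, so `k₁ k₂ = 0`
  have hq : Real.sqrt 6 * ((2 * k 1 * k 2 : ℤ) : ℝ) = ((k 0 ^ 2 - 2 * k 1 ^ 2 - 3 * k 2 ^ 2 : ℤ) : ℝ) := by
    push_cast
    linear_combination (-(k 0 : ℝ) + Real.sqrt 2 * (k 1 : ℝ) + Real.sqrt 3 * (k 2 : ℝ)) * h -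
      2 * (k 1 : ℝ) * (k 2 : ℝ) * hs6 - (k 1 : ℝ) ^ 2 * hs2 - (k 2 : ℝ) ^ 2 * hs3
  have h12 : k 1 = 0 ∨ k 2 = 0 := by
    have := int_eq_zero_of_irrational_mul_eq h6 hq
    simpa [mul_eq_zero] using this
  rcases h12 with h1 | h2'
  · -- `k₁ = 0`: `k₀ + √3 k₂ = 0`
    have hq3 : Real.sqrt 3 * ((k 2 : ℤ) : ℝ) = ((-k 0 : ℤ) : ℝ) := by
      push_cast
      rw [h1] at h
      push_cast at h
      linear_combination h
    have hk2 : k 2 = 0 := int_eq_zero_of_irrational_mul_eq h3 hq3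
    have hk0 : k 0 = 0 := by
      rw [h1, hk2] at h
      push_cast at h
      simpa using h
    refine hk (funext fun i => ?_)
    fin_cases i
    · exact hk0
    · exact h1
    · exact hk2
  · -- `k₂ = 0`: `k₀ + √2 k₁ = 0`
    have hq2 : Real.sqrt 2 * ((k 1 : ℤ) : ℝ) = ((-k 0 : ℤ) : ℝ) := by
      push_cast
      rw [h2'] at h
      push_cast at h
      linear_combination h
    have hk1 : k 1 = 0 := int_eq_zero_of_irrational_mul_eq h2 hq2
    have hk0 : k 0 = 0 := by
      rw [hk1, h2'] at h
      push_cast at h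
      simpa using h
    refine hk (funext fun i => ?_)
    fin_cases i
    · exact hk0
    · exact hk1
    · exact h2'

/-- The Fourier coefficients of the cyclic force on any frequency set `S` form a real solenoidal
coefficient vector: `ĝ|_S ∈ galerkinSubspace S`. [folklore] -/
theorem cycCoeff_mem_galerkinSubspace (S : Finset (Fin 3 → ℤ)) :
    (fun k : ↥S => UnitAddTorus.mFourierCoeff (EuclideanSpace.complexify ∘ fun x : UnitAddTorus (Fin 3) =>
        !₂[(fourier 1 (x 2) : ℂ).im, (fourier 1 (x 0) : ℂ).im, (fourier 1 (x 1) : ℂ).im]) (k : Fin 3 → ℤ)) ∈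
      galerkinSubspace S :=
  ⟨isRealCoeff_mFourierCoeff isSmooth_cycForce.integrable,
    isSolenoidalCoeff_restrict (isDivFree_cycForce.isTransversal_mFourierCoeff isSmooth_cycForce S)⟩

/-- The cyclic force has no mean mode: `ĝ(0) = 0` (the mean mode is off the first shell). [folklore] -/
theorem cycCoeff_zero :
    UnitAddTorus.mFourierCoeff (EuclideanSpace.complexify ∘ fun x : UnitAddTorus (Fin 3) =>
        !₂[(fourier 1 (x 2) : ℂ).im, (fourier 1 (x 0) : ℂ).im, (fourier 1 (x 1) : ℂ).im]) 0 = 0 := by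
  rw [cycForce_eq_realTrigPoly]
  exact mFourierCoeff_realTrigPoly_eq_zero_of_not_mem _ (by decide) (by decide)

/-! ## §3 The stub -/

/-- **stub `stub_farShoreOnWindLine` of crux `CyclicWindLineLoud` (line `birth`) — the far shore lies on
the wind-line.** For the cyclic force `(sin 2πx₃, sin 2πx₁, sin 2πx₂)` and `e = (1, √2, √3)`, at every
viscosity `ν > 0` and resolution `N` there is a wind threshold `s₁` such that every windy steady Galerkin
state `c ∈ V` of wind `s ≥ s₁` (`c 0 = s·e`) lies on the wind-line: its connected component in `V` reaches
every wind `Λ`. Specialisation of `farShore_subset_windLine` to `S = freqBall N` (symmetric, `∋ 0`), the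
cyclic force vector (real, solenoidal, no mean mode) and the non-resonant `e`. [folklore] -/
theorem stub_farShoreOnWindLine :
    ∀ ν : ℝ, 0 < ν → ∀ (N : ℕ) (S : Finset (Fin 3 → ℤ)), S = Literature.Analysis.FunctionSpaces.Torus.freqBall N → ∀ V : Set (↥S → EuclideanSpace ℂ (Fin 3)), V = {c | c ∈ Literature.Analysis.FluidPDE.galerkinSubspace S ∧ (∃ s : ℝ, ∀ k : ↥S, (k : Fin 3 → ℤ) = 0 → c k = (s : ℂ) • !₂[(1 : ℂ), ((Real.sqrt 2 : ℝ) : ℂ), ((Real.sqrt 3 : ℝ) : ℂ)]) ∧ Literature.Analysis.FluidPDE.galerkinRHS S ν (fun k : ↥S => UnitAddTorus.mFourierCoeff (Literature.Analysis.FunctionSpaces.EuclideanSpace.complexify ∘ fun x : UnitAddTorus (Fin 3) => !₂[(fourier 1 (x 2) : ℂ).im, (fourier 1 (x 0) : ℂ).im, (fourier 1 (x 1) : ℂ).im]) (k : Fin 3 → ℤ)) c = 0} → ∃ s₁ : ℝ, ∀ c ∈ V, ∀ s : ℝ, s₁ ≤ s → (∀ k : ↥S, (k : Fin 3 → ℤ)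 = 0 → c k = (s : ℂ) • !₂[(1 : ℂ), ((Real.sqrt 2 : ℝ) : ℂ), ((Real.sqrt 3 : ℝ) : ℂ)]) → ∀ Λ : ℝ, ∃ c' ∈ connectedComponentIn V c, ∃ s' : ℝ, (∀ k : ↥S, (k : Fin 3 → ℤ) = 0 → c' k = (s' : ℂ) • !₂[(1 : ℂ), ((Real.sqrt 2 : ℝ) : ℂ), ((Real.sqrt 3 : ℝ) : ℂ)]) ∧ Λ ≤ s' := by
  intro ν hν N S hS V hV
  have hSsym : ∀ k ∈ S, -k ∈ S := by
    subst hS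
    exact neg_mem_freqBall_of_mem
  have h0 : (0 : Fin 3 → ℤ) ∈ S := by
    subst hS
    exact zero_mem_freqBall N
  rw [← complexify_windDir] at hV ⊢
  obtain ⟨s₁, hs₁⟩ := farShore_subset_windLine hSsym h0 (cycCoeff_mem_galerkinSubspace S) cycCoeff_zero
    (fun k hk => windDir_nonresonant (k : Fin 3 → ℤ) hk) hν hV
  refine ⟨s₁, fun c hc s hs hcs Λ => ?_⟩
  obtain ⟨c', hc', s', hc's, hΛ⟩ := hs₁ c hc s hs ((forall_coe_eq_zero_iff h0).1 hcs) Λ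
  exact ⟨c', hc', s', (forall_coe_eq_zero_iff h0).2 hc's, hΛ⟩

end Summit.AnomalousDissipation.AnomalousDissipation.Theorems.CyclicWindLineLoud.FarShore

end
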